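import Summits.AtomisticToContinuum.Crystallization.Theorems.FreeSplittingCertificatesStrictSplittingRuleP1TableWeights

/-!
# `StrictSplittingRule` (stmt-AtomisticToContinuum-12560): LATTICE COVARIANCE of the matched table weights — they are a function of (parity of the tail site, ledger offset, bond), i.e. H12⋆'s table format (P1 interpolant object, part 17)

Route `FreeSplittingCertificates`, crux r3 `StrictSplittingRule` (H12⋆ = `stub_coreJointCoercive`), unit b2b-freesplit-B gen 22.
VALUE = bookkeeping for the assembly (item (2'') of HOME FAR-LEMMA-SPEC §16 (c)).  H12⋆'s second-order tables are indexed
`M (parity of the placing site q) (p − q) s s'`; the matched receipts weight of part 16 at ledger site `p` is `p1BondW W_p q d` with the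
SITE-CENTRED cell weights `W_p(i) = ∫_{cell i} g(y − y_p)` (`p1SiteW`; `g = χ²|·|⁻⁶` for the split weight).  For an index translation
`t` with `t.1` even (an hcp lattice translation by `y_t`, both sublattices preserved):
* `p1Par_add_even`, `p1Tent_add_even`, `p1ChartInv_add_hcpSite` (`T⁻¹(y + y_t) = T⁻¹y + t`), `p1RealCell_add_even`
  (`cell(n + t, π) = y_t + cell(n, π)`), `setIntegral_p1RealCell_translate`, `p1SiteW_translate` (`W_{p+t}(n+t, π) = W_p(n, π)`),
  `p1BondW_translate`;
* **`p1RecTable a h g b e d`** := the matched weight read at the representative tail `p1Base b` of parity `b` from the ledger site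
  `p1Base b + e`, and **`p1BondW_p1SiteW_eq_p1RecTable`**: `p1BondW W_p q d = p1RecTable a h g (p1Par q) (p − q) d` for ALL `p, q, d` —
  the matched weights ARE a covariant table.
NOT a proof of H12⋆, NOT summit progress.  [folklore]
-/

noncomputable section

open Set Function Metric MeasureTheory Filter Topology
open scoped BigOperators NNReal ENNReal

namespace Summit.AtomisticToContinuum.Crystallization.Theorems.StrictSplittingRuleBirth

open Literature.MathematicalPhysics.StatisticalMechanics
open Summit.AtomisticToContinuum.Crystallization.Theorems.PalmUnimodularRigidity.LayeredLawsSelectHcp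

/-! ## Even-layer index translations -/

/-- Index translations with even first component preserve the layer parity. -/
theorem p1Par_add_even {t : ℤ × ℤ × ℤ} (ht : Even t.1) (n : ℤ × ℤ × ℤ) : p1Par (n + t) = p1Par n := by
  unfold p1Par
  rw [Prod.fst_add]
  have : Even (n.1 + t.1) ↔ Even n.1 := by
    rw [Int.even_add]
    exact ⟨fun h => h.2 ht, fun h => ⟨fun _ => ht, fun _ => h⟩⟩
  exact decide_eq_decide.2 this

/-- The tent function is `2`-periodic: invariant under even integer shifts. -/
theorem p1Tent_add_even {k : ℤ} (hk : Even k) (t : ℝ) : p1Tent (t + k) = p1Tent t := by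
  obtain ⟨m, rfl⟩ := hk
  unfold p1Tent
  have : (t + ((m + m : ℤ) : ℝ)) / 2 = t / 2 + (m : ℝ) := by push_cast; ring
  rw [this, Int.fract_add_intCast]

/-- **The inverse chart is equivariant** under even-layer translations: `T⁻¹(y + y_t) = T⁻¹ y + t`. -/
theorem p1ChartInv_add_hcpSite {a h : ℝ} (ha : a ≠ 0) (hh : h ≠ 0) {t : ℤ × ℤ × ℤ} (ht : Even t.1) (y : Fin 3 → ℝ) :
    p1ChartInv a h (y + fun k => hcpSite a h t k) = p1ChartInv a h y + p1Vec t := by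
  have h0 := hcpSite_apply_zero a h t
  have h1 := hcpSite_apply_one a h t
  have h2 := hcpSite_apply_two a h t
  rw [haggLabel_alternating_of_even ht] at h0 h1
  have hs : (√3 : ℝ) ≠ 0 := by positivity
  have hT : p1Tent ((y 2 + t.1 * h) / h) = p1Tent (y 2 / h) := by
    rw [show (y 2 + t.1 * h) / h = y 2 / h + (t.1 : ℝ) by field_simp, p1Tent_add_even ht]
  ext k
  fin_cases k
  · simp only [Fin.zero_eta, p1ChartInv_apply_zero, Pi.add_apply, h2, p1Vec_zero]
    field_simp
  · simp only [Fin.mk_one, p1ChartInv_apply_one, Pi.add_apply, h0, h1, h2, hT, p1Vec_one]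
    field_simp
    ring
  · simp only [Fin.reduceFinMk, p1ChartInv_apply_two, Pi.add_apply, h1, h2, hT, p1Vec_two]
    field_simp
    ring

/-- **Cells translate**: `cell(n + t, π) = y_t + cell(n, π)` for `t.1` even. -/
theorem p1RealCell_add_even {a h : ℝ} (ha : a ≠ 0) (hh : h ≠ 0) {t : ℤ × ℤ × ℤ} (ht : Even t.1) (n : ℤ × ℤ × ℤ) (π : Fin 6) :
    p1RealCell a h (n + t, π) = {y | (y - fun k => hcpSite a h t k) ∈ p1RealCell a h (n, π)} := by
  ext y
  simp only [p1RealCell, mem_setOf_eq, mem_p1Cell, p1Par_add_even ht]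
  have e : p1ChartInv a h y = p1ChartInv a h (y - fun k => hcpSite a h t k) + p1Vec t := by
    rw [← p1ChartInv_add_hcpSite ha hh ht, sub_add_cancel]
  rw [e, p1Vec_add]
  constructor <;> intro hy <;> [skip; skip] <;> (convert hy using 1; abel)

/-- **Cell integrals translate**: `∫_{cell(n+t,π)} g(y − y_t) dy = ∫_{cell(n,π)} g`. -/
theorem setIntegral_p1RealCell_translate {a h : ℝ} (ha : a ≠ 0) (hh : h ≠ 0) {t : ℤ × ℤ × ℤ} (ht : Even t.1)
    (g : (Fin 3 → ℝ) → ℝ) (n : ℤ × ℤ × ℤ) (π : Fin 6) :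
    ∫ y in p1RealCell a h (n + t, π), g (y - fun k => hcpSite a h t k) = ∫ y in p1RealCell a h (n, π), g y := by
  set c : Fin 3 → ℝ := fun k => hcpSite a h t k with hc
  have hA : p1RealCell a h (n + t, π) = {y | y - c ∈ p1RealCell a h (n, π)} := p1RealCell_add_even ha hh ht n π
  have hmeasB : MeasurableSet (p1RealCell a h (n, π)) := (isClosed_p1RealCell a h _).measurableSet
  have hmeasA : MeasurableSet (p1RealCell a h (n + t, π)) := (isClosed_p1RealCell a h _).measurableSet
  rw [← integral_indicator hmeasA, ← integral_indicator hmeasB]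
  have hind : (fun y => (p1RealCell a h (n + t, π)).indicator (fun y => g (y - c)) y) =
      fun y => ((p1RealCell a h (n, π)).indicator g) (y - c) := by
    funext y
    rw [hA]
    by_cases hy : y - c ∈ p1RealCell a h (n, π)
    · rw [indicator_of_mem (show y ∈ {y | y - c ∈ p1RealCell a h (n, π)} from hy), indicator_of_mem hy]
    · rw [indicator_of_notMem (show y ∉ {y | y - c ∈ p1RealCell a h (n, π)} from hy), indicator_of_notMem hy]
  rw [hind]
  exact integral_sub_right_eq_self _ c

/-! ## Site-centred cell weights and their covariance -/

/-- **Site-centred cell weight**: `W_p(i) = ∫_{cell i} g(y − y_p)` (`g = χ²·|·|⁻⁶` for the ledger's split weight). -/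
def p1SiteW (a h : ℝ) (g : (Fin 3 → ℝ) → ℝ) (p : ℤ × ℤ × ℤ) (i : (ℤ × ℤ × ℤ) × Fin 6) : ℝ :=
  ∫ y in p1RealCell a h i, g (y - fun k => hcpSite a h p k)

/-- **Covariance of the cell weights**: `W_{p+t}(n + t, π) = W_p(n, π)` for `t.1` even. -/
theorem p1SiteW_translate {a h : ℝ} (ha : a ≠ 0) (hh : h ≠ 0) {t : ℤ × ℤ × ℤ} (ht : Even t.1) (g : (Fin 3 → ℝ) → ℝ)
    (p n : ℤ × ℤ × ℤ) (π : Fin 6) : p1SiteW a h g (p + t) (n + t, π) = p1SiteW a h g p (n, π) := by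
  unfold p1SiteW
  have hpt : (fun k => hcpSite a h (p + t) k) = (fun k => hcpSite a h p k) + fun k => hcpSite a h t k := by
    funext k
    rw [add_comm p t, hcpSite_add_of_even a h ht, Pi.add_apply, PiLp.add_apply, add_comm]
  rw [hpt]
  have := setIntegral_p1RealCell_translate ha hh ht (fun z => g (z - fun k => hcpSite a h p k)) n π
  simpa only [sub_sub, add_comm] using this

/-- `W_{p+t}` as a function: the `t`-shift of `W_p`. -/
theorem p1SiteW_add_eq {a h : ℝ} (ha : a ≠ 0) (hh : h ≠ 0) {t : ℤ × ℤ × ℤ} (ht : Even t.1) (g : (Fin 3 → ℝ) → ℝ) (p : ℤ × ℤ × ℤ) :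
    p1SiteW a h g (p + t) = fun i => p1SiteW a h g p (i.1 - t, i.2) := by
  funext i
  obtain ⟨m, π⟩ := i
  have := p1SiteW_translate ha hh ht g p (m - t) π
  rw [sub_add_cancel] at this
  exact this

/-- **Covariance of the bond weights** (pure combinatorics): shifting the cell weights and the tail by `t` (`t.1` even) changes nothing. -/
theorem p1BondW_translate {t : ℤ × ℤ × ℤ} (ht : Even t.1) (W : (ℤ × ℤ × ℤ) × Fin 6 → ℝ) (q d : ℤ × ℤ × ℤ) :
    p1BondW (fun i => W (i.1 - t, i.2)) (q + t) d = p1BondW W q d := by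
  have e : ∀ o : ℤ × ℤ × ℤ, q + t - o = (q - o) + t := fun o => by abel
  simp only [p1BondW, p1SlotW, p1OctW, e, p1Par_add_even ht, add_sub_cancel_right]

/-- Covariance of the matched weights with site-centred cell weights. -/
theorem p1BondW_p1SiteW_translate {a h : ℝ} (ha : a ≠ 0) (hh : h ≠ 0) {t : ℤ × ℤ × ℤ} (ht : Even t.1) (g : (Fin 3 → ℝ) → ℝ)
    (p q d : ℤ × ℤ × ℤ) : p1BondW (p1SiteW a h g (p + t)) (q + t) d = p1BondW (p1SiteW a h g p) q d := by
  rw [p1SiteW_add_eq ha hh ht, p1BondW_translate ht]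

/-! ## The matched weights as a covariant table -/

/-- Representative tail site of each layer parity. -/
def p1Base : Bool → ℤ × ℤ × ℤ
  | true => 0
  | false => (1, 0, 0)

/-- **THE MATCHED RECEIPTS TABLE** in H12⋆'s index format: parity `b` of the placing (tail) site, ledger offset `e = p − q`, bond `d`. -/
def p1RecTable (a h : ℝ) (g : (Fin 3 → ℝ) → ℝ) (b : Bool) (e d : ℤ × ℤ × ℤ) : ℝ :=
  p1BondW (p1SiteW a h g (p1Base b + e)) (p1Base b) d

/-- **THE MATCHED WEIGHTS ARE A COVARIANT TABLE**: `p1BondW W_p q d = p1RecTable (p1Par q) (p − q) d` for all `p, q, d`.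
NOT a proof of H12⋆, NOT summit progress. -/
theorem p1BondW_p1SiteW_eq_p1RecTable {a h : ℝ} (ha : a ≠ 0) (hh : h ≠ 0) (g : (Fin 3 → ℝ) → ℝ) (p q d : ℤ × ℤ × ℤ) :
    p1BondW (p1SiteW a h g p) q d = p1RecTable a h g (p1Par q) (p - q) d := by
  have key : ∀ t : ℤ × ℤ × ℤ, Even t.1 → p1BondW (p1SiteW a h g p) q d = p1BondW (p1SiteW a h g (p - t)) (q - t) d := by
    intro t ht
    have e := p1BondW_p1SiteW_translate ha hh ht g (p - t) (q - t) d
    simp only [sub_add_cancel] at e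
    exact e
  rcases Bool.eq_false_or_eq_true (p1Par q) with hb | hb
  · -- even tail: translate by `t = q`
    have hq : Even q.1 := of_decide_eq_true (show decide (Even q.1) = true from hb)
    rw [hb, key q hq]
    simp only [p1RecTable, p1Base, sub_self, zero_add]
  · -- odd tail: translate by `t = q − (1,0,0)`
    have hq : Odd q.1 := Int.not_even_iff_odd.1 (of_decide_eq_false (show decide (Even q.1) = false from hb))
    have ht : Even (q - (1, 0, 0)).1 := by
      show Even (q.1 - 1)
      exact hq.sub_odd odd_one
    rw [hb, key (q - (1, 0, 0)) ht, show p - (q - (1, 0, 0)) = (1, 0, 0) + (p - q) by abel]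
    simp only [p1RecTable, p1Base, sub_sub_cancel]

end Summit.AtomisticToContinuum.Crystallization.Theorems.StrictSplittingRuleBirth
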